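import Literature.NumberTheory.Automorphic.ConjugateSelfDualInfinityType
import Literature.NumberTheory.Automorphic.QuadraticIdelicNormLocalNorms
import Literature.NumberTheory.ComplexMultiplication.CMTypeBasic
import Literature.NumberTheory.Automorphic.IdeleClassCharacterHecke
import HarnessLib

/-!
# The conjugate `μ^c = μ ∘ c` of an idele class character of a CM field ([Liu21] Remark 4.4) and
# strict unitarity ([Liu21] Definition B.2, Remark 4.2 first sentence)

Topic `NumberTheory/Automorphic`; namespace `Literature.NumberTheory.Automorphic.IdeleClassGroup`
(auxiliary lemmas on CM types in `Literature.NumberTheory.ComplexMultiplication.CMTypeOps`).  Companion of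
`ConjugateSelfDualCharacters` (Def. 4.1 / Def. 4.3: `IsConjugateSelfDual`, `IsConjugateOrthogonal`,
`IsConjugateSymplectic`, `HasWeight`, `HasCMType`, `cmTypeOf`), `ConjugateSelfDualInfinityType` (Remark 4.2:
existence of the ∞-type; the functions `infinityType` / `weightOf` / `cmType` of § 5 there) and
`QuadraticIdelicNormLocalNorms` (Remark 4.2: symplectic ⇒ self-dual, the dichotomy).  `L` is a CM number
field, `L⁺ = maximalRealSubfield L`, `c = IsCMField.complexConj L ∈ Aut(L/L⁺)` (Liu's `E/F` and `c`),
`C_L = IdeleClassGroup L`, characters are the tree's continuous unitary `ψ : C_L →ₜ* S¹`.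

SOURCE.  Y. Liu, *Fourier–Jacobi cycles and arithmetic relative trace formula* (appendix by C. Li and
Y. Zhu), Camb. J. Math. **9** (2021), no. 1, 1–147 = arXiv:2102.11518 [Liu2021].  Quotations are from the
author's TeX source `FJcycle.tex` (arXiv e-print, md5 `6db49a74122d…`), with the line of the held extraction
`paper:arxiv-2102.11518` (chunk `pNNNN`, line `Lk`) as a second locator; the extraction drops macros, the
TeX is authoritative.

AS PRINTED.
* §4.1, running text after Remark 4.2 (TeX l. 1912; p0018 L35): "In what follows, we put `μ^c ≔ μ ∘ c`."
* **Remark 4.4** (`re:mu`, TeX ll. 1930–1933; p0018 L50–51): "It is clear that `μ^c` is conjugate symplectic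
  of the same weight as `μ`. Moreover, we have `M_{μ^c} = M_μ`, `M'_{μ^c} = M'_μ`, and that `Ψ_{μ^c}` is the
  opposite CM type of `Ψ_μ`."  (`M_μ ⊇ M'_μ` = the field of values of `μ^{alg}` and the reflex field of
  `(E, Φ_μ)`; `Ψ_μ` = the induced CM type of `M'_μ`, Def. 4.3 (2).)
* **Definition 4.12**, last sentence (TeX l. 2109; p0020 L51): "It is clear by Remark 4.4 that `ε` is
  `μ`-admissible if and only if `−ε` is `μ^c`-admissible." — where `μ`-admissibility is the condition
  "`τ'(e)` has negative imaginary part for every `τ' ∈ Φ_μ`" (l. 2107), so the sentence uses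
  `Φ_{μ^c} = \bar Φ_μ := {\bar τ' : τ' ∈ Φ_μ}`.
* **Definition B.2** (`de:strictly_unitary`, App. B §B.2, TeX ll. 4249–4251 = extraction 'Definition 8.2',
  p0044 L26–27): "We say that an automorphic character `μ : E^×\𝔸_E^× → ℂ^×` is *strictly unitary* if `μ_∞`
  takes value `1` on the diagonal `Δ^{[F:ℚ]} ℝ^×_{>0} ⊆ (ℝ^×_{>0})^{[F:ℚ]}` as a subgroup of
  `E_∞^× ⊆ 𝔸_E^∞`" [sic; `𝔸_E^×`].  Remark B.3 (l. 4254; p0044 L30): "It is clear that a strictly unitary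
  automorphic character is unitary. For every automorphic character `μ` of `𝔸_E^×`, there exists a unique
  complex number `s` such that `μ|·|^s_E` is strictly unitary."
* **Remark 4.2**, first sentence (TeX l. 1905; p0018 L29): "A conjugate self-dual automorphic character is
  necessarily strictly unitary (Definition B.2)."

WHAT IS HERE (everything PROVED; three definitions with bodies, no named facts, no instances, no `sorry`).
* § 1 `classGalAct σ : C_L →ₜ* C_L` for `σ ∈ Aut(L|K)` (`[y] ↦ [σ • y]`; principal ideles are preserved,
  `smul_mem_principalIdeles`; continuity from `ideleGroup_continuous_smul`), with `classGalAct_mk`,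
  `classGalAct_classGalAct` (`σ ∘ τ = στ`), `classGalAct_one_apply`, `classGalAct_infUnitsToClass`
  (`σ • [(y,1)] = [(σ • y, 1)]`), `classGalAct_classBaseChange` (classes from `K` are fixed),
  `classGalAct_classGalNorm` / `classGalNorm_classGalAct` (the Galois norm is invariant),
  `classGalAct_mk_posRealIdele` (the positive real ideles `z(r)` are fixed).  The conjugate character
  `galConj σ ψ := ψ ∘ classGalAct σ` (`galConj_mk : (galConj σ ψ)[y] = ψ[σ • y]`), and its agreement with the tree's
  Galois conjugate of HECKE characters, `toHeckeCharacter_galConj : toHeckeCharacter (galConj σ ψ) = HeckeCharacter.galConj σ (toHeckeCharacter ψ)`.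
* § 2 (CM field, `σ = c`) **`μ^c`** = `galConj c ψ`: `c ∘ c = 1` on classes, `galConj c (galConj c ψ) = ψ`;
  `classGalNorm L⁺ L x = x · (c • x)`; **`ψ` is conjugate self-dual iff `ψ^c = ψ⁻¹`**
  (`isConjugateSelfDual_iff_galConj_eq_inv`: the printed "trivial on `N 𝔸_E^× = {y ȳ}`");
  `IsConjugateSelfDual.galConj`, `IsConjugateOrthogonal.galConj`, **`IsConjugateSymplectic.galConj`**
  ("`μ^c` is conjugate symplectic") and the `iff` forms.
* § 3 ∞-types: `infinityTypeChar_complexConj_smul` (`χ_e(c • u) = χ_{−e}(u)`: the coordinate of `c • u` at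
  `w` read through `ι_w` is the complex conjugate of that of `u`, `extensionEmbedding_complexConj_smul_units_apply`,
  and `arg(z̄) = arg(z)⁻¹`), **`HasInfinityType.galConj_complexConj`** (the ∞-type of `ψ^c` is `−e`),
  `weight_neg` and **`HasWeight.galConj_complexConj`** ("of the same weight as `μ`"), `exponentAt_neg`,
  `cmTypeOf_neg` (`Φ_{−e} = \bar Φ_e`, the tree's `CMTypeOps.bar`) and **`HasCMType.galConj_complexConj`**
  (**`Φ_{μ^c} = \bar Φ_μ`**, the reading used by Def. 4.12 and by the tree's
  `Liu2021.isAdmissibleElement_conj_neg_iff`, whose index set `{τ' | \bar τ' ∈ Φ}` is `(bar Φ).1`,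
  `CMTypeOps.coe_bar_eq_setOf_conjugate_mem`); the `iff` forms; and for the FUNCTIONS of § 5 of
  `ConjugateSelfDualInfinityType`: `infinityType (ψ^c) = −infinityType ψ`, `weightOf (ψ^c) = weightOf ψ`,
  `cmType (ψ^c) = bar (cmType ψ)` (conjugate symplectic and conjugate self-dual versions).
  **Remark 4.4, first sentence, assembled**: `IsConjugateSymplectic.remark44`.
* § 4 **Definition B.2** `IsStrictlyUnitary L ψ`: `ψ` is trivial on the classes of the positive real ideles
  `z(r) = posRealIdele L r` (`r` diagonally at every infinite place, `1` at the finite places — Liu's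
  diagonal `Δ ℝ_{>0} ⊂ E_∞^×`, `extensionEmbedding_realToInfiniteAdele_apply`); `HasInfinityType.isStrictlyUnitary`
  (a character with a unitary ∞-type `∏_w arg^{e_w}` is strictly unitary — `arg` kills positive reals);
  **`IsConjugateSelfDual.isStrictlyUnitary`** (Remark 4.2, first sentence: `c` fixes `z(r)` and
  `z(r) = z(√r) · \overline{z(√r)}`), `IsConjugateSymplectic.isStrictlyUnitary`,
  `IsConjugateOrthogonal.isStrictlyUnitary`.

NOT HERE.  The field-of-values statements of Remark 4.4 (`M_{μ^c} = M_μ`, `M'_{μ^c} = M'_μ`) and the reflex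
statement "`Ψ_{μ^c}` is the opposite CM type of `Ψ_μ`" — they need `μ^{alg} = μ·|·|_E^{−1/2}` as an algebraic
Hecke character and reflex/induced types of a CHARACTER (the carriers `LiuCMData.M ⊇ M'` of
`Literature/AlgebraicGeometry/Liu2021/CMData` are bundled, not computed from `μ`); the second sentence of
Remark B.3 (the twist `μ|·|^s_E`, which leaves the `S¹`-valued world of `C_L →ₜ* S¹`; its first sentence
"strictly unitary ⇒ unitary" is vacuous here since `ψ` is `S¹`-valued by type); the adèlic collections `ε`
of Def. 4.12 (only the element `e` is modelled, in `Liu2021/AdmissibleElement`).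

## References

* [Liu2021] Y. Liu, *Fourier–Jacobi cycles and arithmetic relative trace formula*, Camb. J. Math. 9 (2021),
  no. 1, 1–147, arXiv:2102.11518 — §4.1 (l. 1912 `μ^c`), Remark 4.2, Remark 4.4, Def. 4.12, App. B Def. B.2 /
  Remark B.3.
* [WeilBNT1967] A. Weil, *Basic Number Theory* (1967), Ch. IV §4 (the positive real ideles `z(λ)`), Ch. VII §3
  (∞-types of characters of `C_K`).
-/

set_option autoImplicit false

noncomputable section

open _root_.Topology
open scoped NNReal
open NumberField NumberField.InfinitePlace NumberField.InfinitePlace.Completion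

namespace Literature.NumberTheory.ComplexMultiplication.CMTypeOps

open NumberField.ComplexEmbedding
open Literature.AlgebraicGeometry.Motives (CMType)

variable {K : Type*} [Field K]

/-- `\bar{\bar Φ} = Φ` (`Φ̄` is the complement `Hom(K, ℂ) ∖ Φ`). [cite: MilneCM2006, Ch. I §1] -/
@[simp] theorem bar_bar (Φ : CMType K) : bar (bar Φ) = Φ :=
  Subtype.ext (compl_compl Φ.1)

/-- `Φ ↦ Φ̄` is injective. [cite: MilneCM2006, Ch. I §1] -/
theorem bar_injective : Function.Injective (bar (K := K)) := fun Φ Φ' h => by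
  rw [← bar_bar Φ, h, bar_bar]

/-- Membership in the conjugate type, conjugate form: `φ ∈ \bar Φ ↔ \bar φ ∈ Φ` (`Φ̄ = ιΦ`). [cite: MilneCM2006, Ch. I §1] -/
theorem mem_bar_iff_conjugate_mem (Φ : CMType K) (φ : K →+* ℂ) : φ ∈ (bar Φ).1 ↔ conjugate φ ∈ Φ.1 := by
  rw [mem_bar_iff, conjugate_mem_iff_notMem]

/-- The conjugate type as the set `{φ | \bar φ ∈ Φ}` — the index set of the tree's
`Liu2021.isAdmissibleElement_conj_neg_iff` ([Liu2021] Def. 4.12, last sentence). [cite: MilneCM2006, Ch. I §1] -/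
theorem coe_bar_eq_setOf_conjugate_mem (Φ : CMType K) : (bar Φ).1 = {φ | conjugate φ ∈ Φ.1} :=
  Set.ext fun φ => mem_bar_iff_conjugate_mem Φ φ

end Literature.NumberTheory.ComplexMultiplication.CMTypeOps

namespace Literature.NumberTheory.Automorphic

open GaloisRepresentations InfiniteAdeleRing Literature.Analysis.Complex
open Literature.AlgebraicGeometry.Motives (CMType)
open Literature.NumberTheory.ComplexMultiplication.CMTypeOps (bar mem_bar_iff bar_bar)

namespace IdeleClassGroup

/-! ## § 1. `Aut(L|K)` acting on idele classes; the conjugate `ψ ∘ σ` of a character -/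

section GalAct

variable {K L : Type} [Field K] [Field L] [Algebra K L] [NumberField L]

/-- **The action of `σ ∈ Aut(L|K)` on the idele class group** `C_L = 𝕀_L / Lˣ`, `[y] ↦ [σ • y]`, as a
continuous group endomorphism (`σ • Lˣ ⊆ Lˣ`, `smul_mem_principalIdeles`; `y ↦ σ • y` is continuous on `𝕀_L`,
`ideleGroup_continuous_smul`) — "The action of `G` on `C_L` is that induced by its action on `J_L`".
[cite: CasselsFrohlichANT1967, Ch. VII §8 (before Prop. 8.1)] -/
def classGalAct (σ : L ≃ₐ[K] L) : IdeleClassGroup L →ₜ* IdeleClassGroup L :=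
  ⟨QuotientGroup.map (principalIdeles L) (principalIdeles L)
      (MulDistribMulAction.toMonoidHom (ideleGroup L) σ) fun _ hx => smul_mem_principalIdeles K L σ hx,
    (QuotientGroup.isQuotientMap_mk (principalIdeles L)).continuous_iff.mpr
      (QuotientGroup.continuous_mk.comp (ideleGroup_continuous_smul K L σ))⟩

/-- `σ • [y] = [σ • y]` (definitional). [cite: CasselsFrohlichANT1967, Ch. VII §8] -/
@[simp] theorem classGalAct_mk (σ : L ≃ₐ[K] L) (y : ideleGroup L) :
    classGalAct σ (y : IdeleClassGroup L) = ((σ • y : ideleGroup L) : IdeleClassGroup L) := rfl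

/-- `σ • (τ • x) = (σ τ) • x` on idele classes. [cite: CasselsFrohlichANT1967, Ch. VII §8] -/
theorem classGalAct_classGalAct (σ τ : L ≃ₐ[K] L) (x : IdeleClassGroup L) :
    classGalAct σ (classGalAct τ x) = classGalAct (σ * τ) x := by
  induction x using QuotientGroup.induction_on with
  | H y => rw [classGalAct_mk, classGalAct_mk, classGalAct_mk, smul_smul]

/-- `1 • x = x` on idele classes. [cite: CasselsFrohlichANT1967, Ch. VII §8] -/
@[simp] theorem classGalAct_one_apply (x : IdeleClassGroup L) : classGalAct (1 : L ≃ₐ[K] L) x = x := by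
  induction x using QuotientGroup.induction_on with
  | H y => rw [classGalAct_mk, one_smul]

/-- `σ • [(y, 1)] = [(σ • y, 1)]` for an infinite idele `y ∈ L_∞ˣ` (`galSmul_infiniteIdeles`; the action respects the
product structure, `(σx)_{σw} = σ_w x_w`). [cite: CasselsFrohlichANT1967, Ch. VII §7.1] -/
theorem classGalAct_infUnitsToClass (σ : L ≃ₐ[K] L) (y : (InfiniteAdeleRing L)ˣ) :
    classGalAct σ (infUnitsToClass L y) = infUnitsToClass L (σ • y) := by
  rw [infUnitsToClass_apply, infUnitsToClass_apply, classGalAct_mk, galSmul_infiniteIdeles]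

/-- The positive real ideles `z(r)` are fixed: `σ • [z(r)] = [z(r)]` (`smul_posRealIdele`; `z(r)` comes from `K = ℚ`-rational
data, `C_K → C_L^G`). [cite: CasselsFrohlichANT1967, Ch. VII §8 Prop. 8.1] -/
theorem classGalAct_mk_posRealIdele (σ : L ≃ₐ[K] L) (r : ℝ≥0ˣ) :
    classGalAct σ ((posRealIdele L r : ideleGroup L) : IdeleClassGroup L) =
      ((posRealIdele L r : ideleGroup L) : IdeleClassGroup L) := by
  rw [classGalAct_mk, smul_posRealIdele]

variable [NumberField K]

/-- Classes coming from `K` are fixed: `σ • ι(a) = ι(a)` for `ι = classBaseChange K L : C_K → C_L`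
(`AdeleRing.smul_ideleBaseChange`) — the map `C_K → C_L^G` of Prop. 8.1. [cite: CasselsFrohlichANT1967, Ch. VII §8 Prop. 8.1] -/
theorem classGalAct_classBaseChange (σ : L ≃ₐ[K] L) (a : IdeleClassGroup K) :
    classGalAct σ (classBaseChange K L a) = classBaseChange K L a := by
  induction a using QuotientGroup.induction_on with
  | H x => rw [classBaseChange_mk, classGalAct_mk, AdeleRing.smul_ideleBaseChange]

/-- The Galois norm is fixed: `σ • N̄ x = N̄ x` (`AdeleRing.smul_ideleGalNorm`; `N = Σ_{σ ∈ G} σ` lands in the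
`G`-invariants). [cite: CasselsFrohlichANT1967, Ch. IV §6 (the norm `N`), Ch. VII §8] -/
theorem classGalAct_classGalNorm (σ : L ≃ₐ[K] L) (x : IdeleClassGroup L) :
    classGalAct σ (classGalNorm K L x) = classGalNorm K L x := by
  induction x using QuotientGroup.induction_on with
  | H y => rw [classGalNorm_mk, classGalAct_mk, AdeleRing.smul_ideleGalNorm]

/-- The Galois norm is invariant: `N̄ (σ • x) = N̄ x` (`AdeleRing.ideleGalNorm_smul`).
[cite: CasselsFrohlichANT1967, Ch. IV §6 (the norm `N`), Ch. VII §8] -/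
theorem classGalNorm_classGalAct (σ : L ≃ₐ[K] L) (x : IdeleClassGroup L) :
    classGalNorm K L (classGalAct σ x) = classGalNorm K L x := by
  induction x using QuotientGroup.induction_on with
  | H y => rw [classGalAct_mk, classGalNorm_mk, classGalNorm_mk, AdeleRing.ideleGalNorm_smul]

omit [NumberField K] in
/-- **The conjugate `ψ ∘ σ` of a continuous unitary idele class character** (`[y] ↦ ψ[σ • y]`); for a CM field
and `σ = c` this is Liu's `μ^c ≔ μ ∘ c` ([Liu2021] §4.1, l. 1912).  Hecke-character analogue:
`GaloisRepresentations.HeckeCharacter.galConj`. [cite: Liu2021, §4.1 (l. 1912, after Remark 4.2)] -/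
def galConj (σ : L ≃ₐ[K] L) (ψ : IdeleClassGroup L →ₜ* Circle) : IdeleClassGroup L →ₜ* Circle :=
  ψ.comp (classGalAct σ)

omit [NumberField K] in
/-- `(ψ ∘ σ) x = ψ (σ • x)` (definitional). [cite: Liu2021, §4.1 (l. 1912)] -/
@[simp] theorem galConj_apply (σ : L ≃ₐ[K] L) (ψ : IdeleClassGroup L →ₜ* Circle) (x : IdeleClassGroup L) :
    galConj σ ψ x = ψ (classGalAct σ x) := rfl

omit [NumberField K] in
/-- `(ψ ∘ σ) [y] = ψ [σ • y]` (definitional). [cite: Liu2021, §4.1 (l. 1912)] -/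
theorem galConj_mk (σ : L ≃ₐ[K] L) (ψ : IdeleClassGroup L →ₜ* Circle) (y : ideleGroup L) :
    galConj σ ψ (y : IdeleClassGroup L) = ψ ((σ • y : ideleGroup L) : IdeleClassGroup L) := rfl

omit [NumberField K] in
/-- `ψ ∘ 1 = ψ`. [cite: Liu2021, §4.1 (l. 1912)] -/
@[simp] theorem galConj_one (ψ : IdeleClassGroup L →ₜ* Circle) : galConj (1 : L ≃ₐ[K] L) ψ = ψ :=
  ContinuousMonoidHom.ext fun x => by rw [galConj_apply, classGalAct_one_apply]

omit [NumberField K] in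
/-- `(ψ ∘ σ) ∘ τ = ψ ∘ (στ)`. [cite: Liu2021, §4.1 (l. 1912)] -/
theorem galConj_galConj (σ τ : L ≃ₐ[K] L) (ψ : IdeleClassGroup L →ₜ* Circle) :
    galConj τ (galConj σ ψ) = galConj (σ * τ) ψ :=
  ContinuousMonoidHom.ext fun x => by rw [galConj_apply, galConj_apply, galConj_apply, classGalAct_classGalAct]

omit [NumberField K] in
/-- **Bridge to Hecke characters**: viewed as a Hecke character `𝕀_L → ℂˣ` (`IdeleClassGroup.toHeckeCharacter`,
`IdeleClassCharacterHecke`), the conjugate `ψ ∘ σ` IS the tree's Galois conjugate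
`GaloisRepresentations.HeckeCharacter.galConj σ` (`CMTypeHeckeCharacter`: `x ↦ χ(σ • x)`) of the Hecke character of
`ψ` — one notion of `μ^c` across the unitary (`C_L →ₜ* S¹`) and the `ℂˣ`-valued (`HeckeCharacter`) worlds.
[cite: Liu2021, §4.1 (l. 1912)] -/
theorem toHeckeCharacter_galConj (σ : L ≃ₐ[K] L) (ψ : IdeleClassGroup L →ₜ* Circle) :
    toHeckeCharacter L (galConj σ ψ) = HeckeCharacter.galConj σ (toHeckeCharacter L ψ) :=
  HeckeCharacter.ext fun x => Units.ext (by
    rw [coe_toHeckeCharacter_apply, HeckeCharacter.galConj_apply, coe_toHeckeCharacter_apply, galConj_mk])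

end GalAct

/-! ## § 2. The CM case: `μ^c = μ ∘ c` and the classes of Definition 4.1 -/

section CM

variable (L : Type) [Field L] [NumberField L] [IsCMField L]

local notation3 "L⁺" => maximalRealSubfield L
local notation3 "𝔠" => IsCMField.complexConj L

/-- `c · c = 1` in `Aut(L/L⁺)` (`IsCMField.orderOf_complexConj`). [folklore] -/
private theorem complexConj_mul_complexConj : 𝔠 * 𝔠 = 1 := by
  rw [← pow_two, ← IsCMField.orderOf_complexConj L, pow_orderOf_eq_one]

variable {L}

/-- `c • (c • x) = x` on idele classes (`c² = 1`). [cite: Liu2021, §4.1 (l. 1912)] -/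
@[simp] theorem classGalAct_complexConj_classGalAct_complexConj (x : IdeleClassGroup L) :
    classGalAct 𝔠 (classGalAct 𝔠 x) = x := by
  rw [classGalAct_classGalAct, complexConj_mul_complexConj, classGalAct_one_apply]

/-- **`(μ^c)^c = μ`.** [cite: Liu2021, §4.1 (l. 1912)] -/
@[simp] theorem galConj_complexConj_galConj_complexConj (ψ : IdeleClassGroup L →ₜ* Circle) :
    galConj 𝔠 (galConj 𝔠 ψ) = ψ := by
  rw [galConj_galConj, complexConj_mul_complexConj, galConj_one]

/-- `μ ↦ μ^c` is injective (an involution). [cite: Liu2021, §4.1 (l. 1912)] -/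
theorem galConj_complexConj_injective :
    Function.Injective (galConj 𝔠 : (IdeleClassGroup L →ₜ* Circle) → (IdeleClassGroup L →ₜ* Circle)) :=
  fun ψ ψ' h => by
    rw [← galConj_complexConj_galConj_complexConj ψ, h, galConj_complexConj_galConj_complexConj]

/-- For a CM field the Galois norm on classes is `N̄ x = x · (c • x)` (`ideleGalNorm_eq_mul_complexConj_smul`):
Liu's `N_{𝔸_E/𝔸_F}`. [cite: Liu2021, Def. 4.1] -/
theorem classGalNorm_eq_mul_classGalAct (x : IdeleClassGroup L) :
    classGalNorm L⁺ L x = x * classGalAct 𝔠 x := by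
  induction x using QuotientGroup.induction_on with
  | H y => rw [classGalNorm_mk, ideleGalNorm_eq_mul_complexConj_smul, QuotientGroup.mk_mul, classGalAct_mk]

/-- **`ψ` is conjugate self-dual iff `ψ^c = ψ⁻¹`** (pointwise: `ψ[ȳ] = ψ[y]⁻¹`) — [Liu2021] Def. 4.1 "trivial on
`N_{𝔸_E/𝔸_F} 𝔸_E^×`", `N y = y ȳ`. [cite: Liu2021, Def. 4.1] -/
theorem isConjugateSelfDual_iff_galConj_eq_inv (ψ : IdeleClassGroup L →ₜ* Circle) :
    IsConjugateSelfDual L ψ ↔ ∀ x : IdeleClassGroup L, galConj 𝔠 ψ x = (ψ x)⁻¹ := by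
  refine forall_congr' fun x => ?_
  rw [classGalNorm_eq_mul_classGalAct, map_mul, galConj_apply, mul_eq_one_iff_eq_inv']

/-- `μ^c` is conjugate self-dual if `μ` is (`N̄` is `c`-invariant). [cite: Liu2021, Def. 4.1, Remark 4.4] -/
theorem IsConjugateSelfDual.galConj {ψ : IdeleClassGroup L →ₜ* Circle} (h : IsConjugateSelfDual L ψ) :
    IsConjugateSelfDual L (galConj 𝔠 ψ) := fun x => by
  rw [galConj_apply, classGalAct_classGalNorm]
  exact h x

/-- `μ^c` is conjugate orthogonal if `μ` is (`c` fixes the classes of `L⁺`). [cite: Liu2021, Def. 4.1, Remark 4.4] -/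
theorem IsConjugateOrthogonal.galConj {ψ : IdeleClassGroup L →ₜ* Circle} (h : IsConjugateOrthogonal L ψ) :
    IsConjugateOrthogonal L (galConj 𝔠 ψ) := fun a => by
  rw [galConj_apply, classGalAct_classBaseChange]
  exact h a

/-- **[Liu2021, Remark 4.4]: "`μ^c` is conjugate symplectic"** (for conjugate symplectic `μ`; `c` fixes the
classes of `L⁺`, on which both are `ε_{L/L⁺}`). [cite: Liu2021, Remark 4.4] -/
theorem IsConjugateSymplectic.galConj {ψ : IdeleClassGroup L →ₜ* Circle} (h : IsConjugateSymplectic L ψ) :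
    IsConjugateSymplectic L (galConj 𝔠 ψ) := fun a => by
  rw [galConj_apply, classGalAct_classBaseChange]
  exact h a

/-- `μ^c` is conjugate self-dual iff `μ` is. [cite: Liu2021, Def. 4.1, Remark 4.4] -/
theorem isConjugateSelfDual_galConj_iff {ψ : IdeleClassGroup L →ₜ* Circle} :
    IsConjugateSelfDual L (galConj 𝔠 ψ) ↔ IsConjugateSelfDual L ψ :=
  ⟨fun h => by simpa only [galConj_complexConj_galConj_complexConj] using h.galConj, fun h => h.galConj⟩

/-- `μ^c` is conjugate orthogonal iff `μ` is. [cite: Liu2021, Def. 4.1, Remark 4.4] -/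
theorem isConjugateOrthogonal_galConj_iff {ψ : IdeleClassGroup L →ₜ* Circle} :
    IsConjugateOrthogonal L (galConj 𝔠 ψ) ↔ IsConjugateOrthogonal L ψ :=
  ⟨fun h => by simpa only [galConj_complexConj_galConj_complexConj] using h.galConj, fun h => h.galConj⟩

/-- `μ^c` is conjugate symplectic iff `μ` is. [cite: Liu2021, Remark 4.4] -/
theorem isConjugateSymplectic_galConj_iff {ψ : IdeleClassGroup L →ₜ* Circle} :
    IsConjugateSymplectic L (galConj 𝔠 ψ) ↔ IsConjugateSymplectic L ψ :=
  ⟨fun h => by simpa only [galConj_complexConj_galConj_complexConj] using h.galConj, fun h => h.galConj⟩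

/-! ## § 3. The ∞-type, weight and CM type of `μ^c` -/

/-- The coordinate at `w` of `c • u`, read in `ℂ` through `ι_w`, is the complex conjugate of that of `u`
(`extensionEmbedding_complexConj_smul_units_apply`; `(σx)_{σw} = σ_w x_w` with `σ_w = ` complex conjugation of
`L_w = ℂ`). [cite: CasselsFrohlichANT1967, Ch. VII §7.1] -/
theorem coe_infLocalUnits_complexConj_smul (u : (InfiniteAdeleRing L)ˣ) (w : InfinitePlace L) :
    ((infLocalUnits L w (𝔠 • u) : ℂˣ) : ℂ) = starRingEnd ℂ ((infLocalUnits L w u : ℂˣ) : ℂ) := by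
  rw [coe_infLocalUnits, coe_infLocalUnits, GaloisRepresentations.ArchHerbrand.val_smul_units,
    extensionEmbedding_complexConj_smul_units_apply]

/-- `arg(z̄) = arg(z)⁻¹` in `S¹` (for `z' ∈ ℂˣ` with value `z̄`). [folklore] -/
private theorem unitPart_eq_inv_of_coe_eq_conj {z z' : ℂˣ} (h : (z' : ℂ) = starRingEnd ℂ (z : ℂ)) :
    unitPart z' = (unitPart z)⁻¹ :=
  Circle.ext (by rw [Circle.coe_inv_eq_conj, coe_unitPart, coe_unitPart, h, Complex.norm_conj, map_div₀,
    Complex.conj_ofReal])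

/-- **`χ_e (c • u) = χ_{−e} (u)`**: the ∞-type character `u ↦ ∏_w arg(ι_w u_w)^{e_w}` at the conjugate idele is the
∞-type character of `−e` (conjugation inverts `arg`) — the computation behind Remark 4.4. [cite: Liu2021, Remark 4.4] -/
theorem infinityTypeChar_complexConj_smul (e : InfinitePlace L → ℤ) (u : (InfiniteAdeleRing L)ˣ) :
    infinityTypeChar L e (𝔠 • u) = infinityTypeChar L (-e) u := by
  rw [infinityTypeChar_apply, infinityTypeChar_apply]
  refine Finset.prod_congr rfl fun w _ => ?_
  rw [unitPart_eq_inv_of_coe_eq_conj (coe_infLocalUnits_complexConj_smul u w), inv_zpow', Pi.neg_apply]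

/-- **The ∞-type of `μ^c` is `−e`** (the components of `μ^c` are those of `μ` read through the conjugate
embeddings: `𝔴` is unchanged and the distinguished member of `{τ', \bar τ'}` flips). [cite: Liu2021, Remark 4.4] -/
theorem HasInfinityType.galConj_complexConj {ψ : IdeleClassGroup L →ₜ* Circle} {e : InfinitePlace L → ℤ}
    (he : HasInfinityType L ψ e) : HasInfinityType L (galConj 𝔠 ψ) (-e) := fun u => by
  rw [galConj_apply, classGalAct_infUnitsToClass, he, infinityTypeChar_complexConj_smul]

/-- `μ^c` has ∞-type `e` iff `μ` has ∞-type `−e`. [cite: Liu2021, Remark 4.4] -/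
theorem hasInfinityType_galConj_iff {ψ : IdeleClassGroup L →ₜ* Circle} {e : InfinitePlace L → ℤ} :
    HasInfinityType L (galConj 𝔠 ψ) e ↔ HasInfinityType L ψ (-e) := by
  constructor
  · intro h
    have h' := h.galConj_complexConj
    rwa [galConj_complexConj_galConj_complexConj] at h'
  · intro h
    have h' := h.galConj_complexConj
    rwa [neg_neg] at h'

omit [NumberField L] [IsCMField L] in
/-- `𝔴(−e) = 𝔴(e)` (`|−e_w| = |e_w|`): the weight (Def. 4.3) only sees `|e_w|`. [cite: Liu2021, Def. 4.3 / Remark 4.4] -/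
@[simp] theorem weight_neg (e : InfinitePlace L → ℤ) : weight (-e) = weight e :=
  funext fun w => by rw [weight_apply, weight_apply, Pi.neg_apply, Int.natAbs_neg]

/-- **[Liu2021, Remark 4.4]: "`μ^c` is … of the same weight as `μ`".** [cite: Liu2021, Remark 4.4] -/
theorem HasWeight.galConj_complexConj {ψ : IdeleClassGroup L →ₜ* Circle} {𝔴 : InfinitePlace L → ℕ}
    (h : HasWeight L ψ 𝔴) : HasWeight L (galConj 𝔠 ψ) 𝔴 := by
  obtain ⟨e, he, rfl⟩ := h
  exact ⟨-e, he.galConj_complexConj, weight_neg e⟩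

/-- `μ^c` has weight `𝔴` iff `μ` does. [cite: Liu2021, Remark 4.4] -/
theorem hasWeight_galConj_iff {ψ : IdeleClassGroup L →ₜ* Circle} {𝔴 : InfinitePlace L → ℕ} :
    HasWeight L (galConj 𝔠 ψ) 𝔴 ↔ HasWeight L ψ 𝔴 := by
  constructor
  · intro h
    have h' := h.galConj_complexConj
    rwa [galConj_complexConj_galConj_complexConj] at h'
  · exact fun h => h.galConj_complexConj

omit [NumberField L] [IsCMField L] in
/-- The exponent of `−e` in every coordinate is minus that of `e`. [cite: Liu2021, Remark 4.2 / Remark 4.4] -/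
theorem exponentAt_neg (e : InfinitePlace L → ℤ) (φ : L →+* ℂ) : exponentAt (-e) φ = -exponentAt e φ := by
  unfold exponentAt
  split_ifs <;> simp

omit [NumberField L] [IsCMField L] in
/-- `−e` is zero-free when `e` is. [folklore] -/
private theorem neg_apply_ne_zero {e : InfinitePlace L → ℤ} (he : ∀ w, e w ≠ 0) (w : InfinitePlace L) : (-e) w ≠ 0 := by
  rw [Pi.neg_apply, neg_ne_zero]
  exact he w

/-- **`Φ_{−e} = \bar Φ_e`**: negating a zero-free ∞-type replaces its CM type by the conjugate type (the tree's
`CMTypeOps.bar`, as a set the complement). [cite: Liu2021, Remark 4.4 / Def. 4.12] -/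
theorem cmTypeOf_neg (e : InfinitePlace L → ℤ) (he : ∀ w, e w ≠ 0) (he' : ∀ w, (-e) w ≠ 0) :
    cmTypeOf L (-e) he' = bar (cmTypeOf L e he) := by
  apply Subtype.ext
  ext φ
  change exponentAt (-e) φ < 0 ↔ φ ∈ (bar (cmTypeOf L e he)).1
  rw [mem_bar_iff, mem_cmTypeOf_iff, exponentAt_neg, neg_lt_zero, not_lt]
  have h := exponentAt_ne_zero he φ
  exact ⟨fun h1 => h1.le, fun h1 => lt_of_le_of_ne h1 (Ne.symm h)⟩

/-- **`Φ_{μ^c} = \bar Φ_μ`** — the reading of [Liu2021] Def. 4.12 ("by Remark 4.4 … `ε` is `μ`-admissible iff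
`−ε` is `μ^c`-admissible"): if `μ` has CM type `Φ` then `μ^c` has CM type `\bar Φ`.
[cite: Liu2021, Remark 4.4 / Def. 4.12] -/
theorem HasCMType.galConj_complexConj {ψ : IdeleClassGroup L →ₜ* Circle} {Φ : CMType L}
    (h : HasCMType L ψ Φ) : HasCMType L (galConj 𝔠 ψ) (bar Φ) := by
  obtain ⟨e, he, hψe, rfl⟩ := h
  exact ⟨-e, neg_apply_ne_zero he, hψe.galConj_complexConj, cmTypeOf_neg e he _⟩

/-- `μ^c` has CM type `Φ` iff `μ` has CM type `\bar Φ`. [cite: Liu2021, Remark 4.4 / Def. 4.12] -/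
theorem hasCMType_galConj_iff {ψ : IdeleClassGroup L →ₜ* Circle} {Φ : CMType L} :
    HasCMType L (galConj 𝔠 ψ) Φ ↔ HasCMType L ψ (bar Φ) := by
  constructor
  · intro h
    have h' := h.galConj_complexConj
    rwa [galConj_complexConj_galConj_complexConj] at h'
  · intro h
    have h' := h.galConj_complexConj
    rwa [bar_bar] at h'

/-- **[Liu2021, Remark 4.4, first sentence], assembled**: "It is clear that `μ^c` is conjugate symplectic of the
same weight as `μ`" — and `Φ_{μ^c} = \bar Φ_μ`. [cite: Liu2021, Remark 4.4] -/
theorem IsConjugateSymplectic.remark44 {ψ : IdeleClassGroup L →ₜ* Circle} (hψ : IsConjugateSymplectic L ψ)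
    {𝔴 : InfinitePlace L → ℕ} (h𝔴 : HasWeight L ψ 𝔴) {Φ : CMType L} (hΦ : HasCMType L ψ Φ) :
    IsConjugateSymplectic L (IdeleClassGroup.galConj 𝔠 ψ) ∧ HasWeight L (IdeleClassGroup.galConj 𝔠 ψ) 𝔴 ∧
      HasCMType L (IdeleClassGroup.galConj 𝔠 ψ) (bar Φ) :=
  ⟨hψ.galConj, h𝔴.galConj_complexConj, hΦ.galConj_complexConj⟩

/-! ### The functions `infinityType`, `weightOf`, `cmType` (§ 5 of `ConjugateSelfDualInfinityType`) at `μ^c` -/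

/-- The ∞-type of `μ^c` (as a function) is minus that of `μ`. [cite: Liu2021, Remark 4.4] -/
theorem IsConjugateSelfDual.infinityType_galConj {ψ : IdeleClassGroup L →ₜ* Circle}
    (hψ : IsConjugateSelfDual L ψ) : hψ.galConj.infinityType = -hψ.infinityType :=
  hψ.galConj.infinityType_eq hψ.hasInfinityType_infinityType.galConj_complexConj

/-- `𝔴_{μ^c} = 𝔴_μ` for conjugate self-dual `μ`. [cite: Liu2021, Remark 4.4] -/
theorem IsConjugateSelfDual.weightOf_galConj {ψ : IdeleClassGroup L →ₜ* Circle}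
    (hψ : IsConjugateSelfDual L ψ) : hψ.galConj.weightOf = hψ.weightOf :=
  hψ.galConj.weightOf_eq hψ.hasWeight_weightOf.galConj_complexConj

/-- The ∞-type of `μ^c` (as a function) is minus that of `μ`, conjugate symplectic version.
[cite: Liu2021, Remark 4.4] -/
theorem IsConjugateSymplectic.infinityType_galConj {ψ : IdeleClassGroup L →ₜ* Circle}
    (hψ : IsConjugateSymplectic L ψ) : hψ.galConj.infinityType = -hψ.infinityType :=
  hψ.galConj.infinityType_eq hψ.hasInfinityType_infinityType.galConj_complexConj

/-- **`𝔴_{μ^c} = 𝔴_μ`** ([Liu2021] Remark 4.4 "of the same weight"), for the function `weightOf`.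
[cite: Liu2021, Remark 4.4] -/
theorem IsConjugateSymplectic.weightOf_galConj {ψ : IdeleClassGroup L →ₜ* Circle}
    (hψ : IsConjugateSymplectic L ψ) : hψ.galConj.weightOf = hψ.weightOf :=
  hψ.galConj.weightOf_eq hψ.hasWeight_weightOf.galConj_complexConj

/-- **`Φ_{μ^c} = \bar Φ_μ`** for the function `cmType` of a conjugate symplectic character.
[cite: Liu2021, Remark 4.4 / Def. 4.12] -/
theorem IsConjugateSymplectic.cmType_galConj {ψ : IdeleClassGroup L →ₜ* Circle}
    (hψ : IsConjugateSymplectic L ψ) : hψ.galConj.cmType = bar hψ.cmType :=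
  hψ.galConj.cmType_eq hψ.hasCMType_cmType.galConj_complexConj

end CM

/-! ## § 4. Strict unitarity ([Liu2021] Definition B.2; Remark 4.2, first sentence) -/

section StrictlyUnitary

variable (K : Type) [Field K] [NumberField K]

/-- **Strictly unitary** ([Liu2021] App. B, Definition B.2: "`μ_∞` takes value `1` on the diagonal
`Δ^{[F:ℚ]} ℝ^×_{>0} ⊆ (ℝ^×_{>0})^{[F:ℚ]}` as a subgroup of `E_∞^×`"): the continuous unitary idele class character
`ψ : C_K →ₜ* S¹` is trivial on the classes of the positive real ideles `z(r) = posRealIdele K r` — the idele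
which is the real number `r > 0` at EVERY infinite place (`extensionEmbedding_realToInfiniteAdele_apply`) and
`1` at the finite places, i.e. Liu's diagonal. [cite: Liu2021, App. B Definition B.2 (arXiv Definition 8.2, p. 44)] -/
def IsStrictlyUnitary (ψ : IdeleClassGroup K →ₜ* Circle) : Prop :=
  ∀ r : ℝ≥0ˣ, ψ ((posRealIdele K r : ideleGroup K) : IdeleClassGroup K) = 1

variable {K}

/-- Unfolding `IsStrictlyUnitary`. [cite: Liu2021, App. B Definition B.2] -/
theorem isStrictlyUnitary_iff (ψ : IdeleClassGroup K →ₜ* Circle) :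
    IsStrictlyUnitary K ψ ↔ ∀ r : ℝ≥0ˣ, ψ ((posRealIdele K r : ideleGroup K) : IdeleClassGroup K) = 1 :=
  Iff.rfl

/-- The positive real idele `z(r)` is the infinite idele `(r_∞, 1)` of the diagonal archimedean unit `r_∞` (Weil's
`z_λ`). [cite: WeilBNT1967, Ch. IV §4] -/
theorem posRealIdele_eq_infiniteIdeles (r : ℝ≥0ˣ) :
    posRealIdele K r =
      infiniteIdeles K (Units.map (realToInfiniteAdele K).toMonoidHom (Units.map NNReal.toRealHom.toMonoidHom r)) :=
  Units.ext (Prod.ext (by rw [posRealIdele_fst, coe_infiniteIdeles_eq, Units.coe_map, Units.coe_map]; rfl)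
    (by rw [posRealIdele_snd, coe_infiniteIdeles_eq]))

/-- **A character with a unitary ∞-type is strictly unitary**: `∏_w arg(ι_w u_w)^{e_w} = 1` at the diagonal
positive real unit (`arg` of a positive real number is `1`).  So every character of the tree's `HasInfinityType`
world is strictly unitary in Liu's sense. [cite: Liu2021, App. B Definition B.2; WeilBNT1967, Ch. VII §3] -/
theorem HasInfinityType.isStrictlyUnitary {ψ : IdeleClassGroup K →ₜ* Circle} {e : InfinitePlace K → ℤ}
    (he : HasInfinityType K ψ e) : IsStrictlyUnitary K ψ := fun r => by
  rw [posRealIdele_eq_infiniteIdeles, ← infUnitsToClass_apply, he, infinityTypeChar_apply]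
  refine Finset.prod_eq_one fun w _ => ?_
  have hval : ((infLocalUnits K w (Units.map (realToInfiniteAdele K).toMonoidHom
      (Units.map NNReal.toRealHom.toMonoidHom r)) : ℂˣ) : ℂ) = ((((r : ℝ≥0ˣ) : ℝ≥0) : ℝ) : ℂ) := by
    rw [coe_infLocalUnits, Units.coe_map, Units.coe_map]
    exact extensionEmbedding_realToInfiniteAdele_apply K _ w
  have hpos : (0 : ℝ) < ((r : ℝ≥0ˣ) : ℝ≥0) := NNReal.coe_pos.mpr (pos_iff_ne_zero.mpr r.ne_zero)
  have h1 : unitPart (infLocalUnits K w (Units.map (realToInfiniteAdele K).toMonoidHom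
      (Units.map NNReal.toRealHom.toMonoidHom r))) = 1 :=
    Circle.ext (by
      rw [coe_unitPart, hval, Complex.norm_real, Real.norm_of_nonneg hpos.le, Circle.coe_one,
        div_self (Complex.ofReal_ne_zero.mpr hpos.ne')])
  rw [h1, one_zpow]

variable {L : Type} [Field L] [NumberField L] [IsCMField L]

/-- **[Liu2021, Remark 4.2, first sentence]: "A conjugate self-dual automorphic character is necessarily
strictly unitary."**  Proof: `c` fixes `z(t)` (`smul_posRealIdele`), so `z(r) = z(√r) · \overline{z(√r)}` is a norm
and `ψ` kills it (`isConjugateSelfDual_iff_mul_conj`). [cite: Liu2021, Remark 4.2] -/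
theorem IsConjugateSelfDual.isStrictlyUnitary {ψ : IdeleClassGroup L →ₜ* Circle}
    (hψ : IsConjugateSelfDual L ψ) : IsStrictlyUnitary L ψ := fun r => by
  set t : ℝ≥0ˣ := Units.mk0 (NNReal.sqrt (r : ℝ≥0)) (by rw [Ne, NNReal.sqrt_eq_zero]; exact r.ne_zero) with ht
  have hr : r = t * t := Units.ext (by simp [ht])
  have h := (isConjugateSelfDual_iff_mul_conj ψ).1 hψ (posRealIdele L t)
  rwa [smul_posRealIdele, ← map_mul, ← hr] at h

/-- A conjugate symplectic character is strictly unitary (it is conjugate self-dual,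
`IsConjugateSymplectic.isConjugateSelfDual` of `QuadraticIdelicNormLocalNorms`). [cite: Liu2021, Remark 4.2] -/
theorem IsConjugateSymplectic.isStrictlyUnitary {ψ : IdeleClassGroup L →ₜ* Circle}
    (hψ : IsConjugateSymplectic L ψ) : IsStrictlyUnitary L ψ :=
  hψ.isConjugateSelfDual.isStrictlyUnitary

/-- A conjugate orthogonal character is strictly unitary. [cite: Liu2021, Remark 4.2] -/
theorem IsConjugateOrthogonal.isStrictlyUnitary {ψ : IdeleClassGroup L →ₜ* Circle}
    (hψ : IsConjugateOrthogonal L ψ) : IsStrictlyUnitary L ψ :=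
  hψ.isConjugateSelfDual.isStrictlyUnitary

/-- `μ^c` is strictly unitary iff `μ` is (`c` fixes `z(r)`). [cite: Liu2021, App. B Definition B.2] -/
theorem isStrictlyUnitary_galConj_iff {ψ : IdeleClassGroup L →ₜ* Circle} :
    IsStrictlyUnitary L (galConj (IsCMField.complexConj L) ψ) ↔ IsStrictlyUnitary L ψ := by
  refine forall_congr' fun r => ?_
  rw [galConj_apply, classGalAct_mk_posRealIdele]

end StrictlyUnitary

end IdeleClassGroup

end Literature.NumberTheory.Automorphic

end
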